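import Literature.Computability.QuantumComplexity.BQPSubroutine
import Literature.Computability.QuantumComplexity.RenumberDesc
import Literature.Computability.QuantumComplexity.CliffordTInverseCodeFP
import Literature.Computability.QuantumComplexity.CWrapUniform
import Literature.Computability.Complexity.FPStringBricks
import HarnessLib

/-!
# Uniformity of the tidy subroutines and of the substituted family (BBBV 1997, Thm. 4.14 / Cor. 4.15: the time bounds)

Sequel of `TidyBlock.lean`, `BQPSubroutine.lean`, `OracleSubstitution.lean` and `RenumberDesc.lean`,
proving the two running-time statements of Bennett–Bernstein–Brassard–Vazirani 1997, Thm. 4.14 and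
Cor. 4.15 in the tree's circuit model — the hypotheses `hunif` of `isQSolvable_of_tidyFamily`:

Part A — **`DeciderFamily.tidy_isUniform`**: for a decider family `D` uniform in `⟨1^k, 1^r⟩`
(`DeciderFamily.IsUniform`) and oracle-free, the tidy family `D.tidy` (circuits
`TidyBlock.tidyCirc (D.circ k r)`: the `k` copy CNOTs, the decider transported to the wires from `k + 1`
on, the answer CNOT, the inverse decider, the copy CNOTs again — "run, copy, reverse", proof of
Thm. 4.14 with Lemma 4.11) is uniform. The description is assembled in the `FP` string algebra: the
CNOTs are compiled reversible operations printed by one-counter generator programs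
(`GStmt.render_out_mem_FP`); the transported decider is its description with every wire shifted by
`k + 1` (the renumbering brick `RenumDesc.renumF` with the empty table); the transported inverse is the
shift of the inverse code `InvCode.invCodeFn` (`encode_inv`); the description of `D.circ k r` is the
two-parameter description function `DeciderFamily.ddF` (in `FP` by composing the uniformity machine
with the normaliser `z ↦ ⟨1^{|fst z|}, 1^{|snd z|}⟩`).

Part B — **`substFamily_isUniform`**: `F.IsUniform → S.IsUniform →
(OracleImpl.substFamily F fun n => S.fix (q.eval n)).IsUniform` for every polynomial `q` and tidy
family `S`. The description of the substituted family is computed by **one counted loop over the gate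
codes of `F.circ n`** (`Brick.loopStep`, `|x|` rounds, context `x = ⟨yardstick, 1^{q n}⟩`, Arora–Barak
2009, §1.3 / Remark 6.7) with state `⟨remaining codes, ⟨offset in binary, emitted codes⟩⟩`: a gate code
is emitted verbatim (`encode_mapWiresGate_castLE`); an oracle code `1 ⟨bin k, ⟨1^{k+1}, wires e⟩⟩` is
replaced by the codes of the block `S.circ k (q n)` (from the two-parameter description function
`TidyFamily.ddF` at `⟨1^k, 1^{q n}⟩`, `binToUnaryFn` for `1^k`) renumbered by `RenumDesc.renumF` with
table `e` and the current offset (the values of `OracleImpl.blockEmb`), the offset advancing by the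
block's ancilla count; the header is `bin n` and `1^{F.ancillas n} 1^{extra}`. The loop body has
polynomial growth in the context (`loopFn_mem_FP_of_poly`, bounds from
`exists_poly_length_le_of_mem_FP` for the description functions of `F` and `S`); the yardstick is a
run of ones longer than every quantity the value lemmas need (`SubstUniform.descF_apply`).

## References

* C. H. Bennett, E. Bernstein, G. Brassard, U. Vazirani, *Strengths and weaknesses of quantum
  computing*, SIAM J. Comput. 26 (1997) 1510–1523, Thm. 4.14 (time bound `cT(n)`), Lemma 4.11
  (reversal), Cor. 4.15 (`BQP^BQP = BQP`) [BennettBernsteinBrassardVazirani1997].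
* S. Arora, B. Barak, *Computational Complexity: A Modern Approach*, CUP 2009, §1.3, §6.2 Def. 6.12
  and Remark 6.7 [AroraBarak2009].
-/

noncomputable section


namespace Literature.Computability.QuantumComplexity

open _root_.Computability Polynomial Complexity Complexity.Brick Plumb RevDesc RevSim RevClean Cryptography

/-! ### The two-parameter description function of a decider family -/

namespace DeciderFamily

variable (D : DeciderFamily cliffordT)

/-- **The description function on all strings**: `z ↦ sigmaEncode ⟨k, anc k r, circ k r⟩` with
`k = |fst z|`, `r = |snd z|`. [cite: AroraBarak2009, §6.2 (P-uniform circuit families)] -/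
def ddF (z : List Bool) : List Bool :=
  QCircuit.sigmaEncode (G := cliffordT) ⟨(fstF z).length, D.anc (fstF z).length (sndF z).length, D.circ (fstF z).length (sndF z).length⟩

variable {D}

/-- The length of a unary numeral. [folklore] -/
theorem length_unaryEncodeNat (n : ℕ) : (unaryEncodeNat n).length = n := Computability.unary_decode_encode_nat n

/-- The normaliser `z ↦ ⟨1^{|fst z|}, 1^{|snd z|}⟩`. [folklore] -/
def normF : List Bool → List Bool := fanoutFn (onesFn ∘ fstF) (onesFn ∘ sndF)

/-- The normaliser is in `FP`. [folklore] -/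
theorem normF_mem_FP : normF ∈ FP :=
  fanoutFn_mem_FP (comp_mem_FP onesFn_mem_FP fstF_mem_FP) (comp_mem_FP onesFn_mem_FP sndF_mem_FP)

/-- The normaliser prints the canonical two-parameter input. [folklore] -/
theorem normF_eq (z : List Bool) : normF z = unaryPairEncode ((fstF z).length, (sndF z).length) := by
  rw [normF, fanoutFn_apply]; rfl

/-- The parse `z ↦ (|fst z|, |snd z|)` is polynomial-time into the canonical encoding. [folklore] -/
theorem parse_polyTime : PolyTimeComputable (fun x : List Bool => x) unaryPairEncode (fun z : List Bool => ((fstF z).length, (sndF z).length)) :=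
  PolyTimeComputable.of_encode (ea := fun x : List Bool => x) (eb := unaryPairEncode)
    (f := fun z : List Bool => ((fstF z).length, (sndF z).length)) normF_mem_FP (fun z => z) (fun _ => rfl) (fun z => normF_eq z)

/-- **A uniform decider family has an `FP` description function.** [cite: AroraBarak2009, §6.2 Def. 6.12 and Remark 6.7] -/
theorem ddF_mem_FP_of_isUniform (h : D.IsUniform) : D.ddF ∈ FP := by
  have hc := PolyTimeComputable.comp_holds h parse_polyTime
  exact PolyTimeComputable.of_encode (ea := fun x : List Bool => x) (eb := fun x : List Bool => x) (f := D.ddF) hc (fun z => z)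
    (fun _ => rfl) (fun _ => rfl)

/-- `ddF` on the canonical input. [folklore] -/
theorem ddF_apply (k r : ℕ) : D.ddF (unaryPairEncode (k, r)) =
    boolPair (encodeNat k) (boolPair (unaryEncodeNat (D.anc k r)) (D.circ k r).encode) := by
  have hk : (fstF (unaryPairEncode (k, r))).length = k := by simp [unaryPairEncode, length_unaryEncodeNat]
  have hr : (sndF (unaryPairEncode (k, r))).length = r := by simp [unaryPairEncode, length_unaryEncodeNat]
  unfold ddF
  have key : ∀ m s, m = k → s = r → QCircuit.sigmaEncode (G := cliffordT) ⟨m, D.anc m s, D.circ m s⟩ =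
      boolPair (encodeNat k) (boolPair (unaryEncodeNat (D.anc k r)) (D.circ k r).encode) := by
    rintro m s rfl rfl; rfl
  exact key _ _ hk hr

end DeciderFamily

/-! ### The description of the tidy block -/

namespace TidyUniform

open TidyBlock

variable (D : DeciderFamily cliffordT)

/-- The decider's ancilla count in unary, from `z`. [folklore] -/
def dUF : List Bool → List Bool := fstF ∘ sndF ∘ D.ddF

/-- The decider's description (gate codes), from `z`. [folklore] -/
def bodyF : List Bool → List Bool := sndF ∘ sndF ∘ D.ddF

/-- The yardstick: a run of ones of length `8 (|ddF z| + |z|) + 8`. [folklore] -/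
def yardF : List Bool → List Bool := polyFn (C 8 * X + C 8) ∘ fun z => D.ddF z ++ z

/-- The shift parameter record `⟨bin 0, ⟨encList [], bin (k+1)⟩⟩`. [folklore] -/
def prmF : List Bool → List Bool :=
  fanoutFn (fun _ => []) (fanoutFn (fun _ => []) (lenBinF ∘ List.cons true ∘ fstF))

/-- The transported decider: shift every wire by `k + 1`. [folklore] -/
def decF : List Bool → List Bool := RenumDesc.renumF ∘ fanoutFn (yardF D) (fanoutFn (prmF) (bodyF D))

/-- The transported inverse decider: inverse code, then shift. [folklore] -/
def invF : List Bool → List Bool := RenumDesc.renumF ∘ fanoutFn (yardF D) (fanoutFn (prmF) (InvCode.invCodeFn ∘ bodyF D))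

/-- The generator of the copy CNOTs: `for j < k: CNOT j (k + 1 + j)`. [cite: AroraBarak2009, §6.2 (descriptions printed with counters)] -/
def genCopy : GS :=
  GStmt.loop .jj (.var .uu) (opsG [ClOp.cnot (.var .jj) (.add (.add (.var .uu) (.const 1)) (.var .jj))])

/-- The generator of the answer CNOT: `CNOT (k + 1) k`. [folklore] -/
def genAns : GS := opsG [ClOp.cnot (.add (.var .uu) (.const 1)) (.var .uu)]

/-- The copy CNOT bits as a function of `u` (`|u| = k`). [folklore] -/
def copyBitsF : List Bool → List Bool := fun u => Tok.render 0 (genCopy.out (GenProg.initEnv GV.uu u.length))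

/-- The answer CNOT bits as a function of `u` (`|u| = k`). [folklore] -/
def ansBitsF : List Bool → List Bool := fun u => Tok.render 0 (genAns.out (GenProg.initEnv GV.uu u.length))

/-- The answer part: empty iff `k + d = 0`. [folklore] -/
def ansF : List Bool → List Bool :=
  iteFn (isNilFn ∘ fun z => fstF z ++ dUF D z) (fun _ => []) (ansBitsF ∘ fstF)

/-- **The description of the tidy block** as a string function of `z` (canonically `⟨1^k, 1^r⟩`).
[cite: BennettBernsteinBrassardVazirani1997, Thm. 4.14 (proof: run, copy, reverse)] -/
def descF : List Bool → List Bool :=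
  fanoutFn (lenBinF ∘ List.cons true ∘ fstF) (fanoutFn (fun z => fstF z ++ dUF D z)
    (fun z => copyBitsF (fstF z) ++ (decF D z ++ (ansF D z ++ (invF D z ++ copyBitsF (fstF z))))))

variable {D}

/-! ### Membership in `FP` -/

/-- `copyBitsF ∈ FP`. [cite: AroraBarak2009, §6.2 Def. 6.12 and Remark 6.7] -/
theorem copyBitsF_mem_FP : copyBitsF ∈ FP := by
  have hx : GV.uu ∉ genCopy.loopVars := fun h => by
    simp only [genCopy, GStmt.loopVars, List.mem_cons] at h
    rcases h with h | h
    · exact absurd h (by decide)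
    · exact absurd (loopVars_opsG_sub _ _ h) (by decide)
  exact GStmt.render_out_mem_FP genCopy GV.uu hx (noReuse_loop_of (lv_opsG (by decide) _) (noReuse_opsG _))

/-- `ansBitsF ∈ FP`. [folklore] -/
theorem ansBitsF_mem_FP : ansBitsF ∈ FP := by
  have hx : GV.uu ∉ genAns.loopVars := fun h => absurd (loopVars_opsG_sub _ _ h) (by decide)
  exact GStmt.render_out_mem_FP genAns GV.uu hx (noReuse_opsG _)

/-- `prmF ∈ FP`. [folklore] -/
theorem prmF_mem_FP : prmF ∈ FP :=
  fanoutFn_mem_FP (const_mem_FP _) (fanoutFn_mem_FP (const_mem_FP _) (comp_mem_FP lenBinF_mem_FP (comp_mem_FP (cons_mem_FP true) fstF_mem_FP)))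

/-- **`descF ∈ FP`** for a uniform `D`. [cite: AroraBarak2009, §6.2 Def. 6.12 and Remark 6.7] -/
theorem descF_mem_FP (hU : D.IsUniform) : descF D ∈ FP := by
  have hdd := DeciderFamily.ddF_mem_FP_of_isUniform hU
  have hdU : dUF D ∈ FP := comp_mem_FP fstF_mem_FP (comp_mem_FP sndF_mem_FP hdd)
  have hbody : bodyF D ∈ FP := comp_mem_FP sndF_mem_FP (comp_mem_FP sndF_mem_FP hdd)
  have hyard : yardF D ∈ FP := comp_mem_FP (polyFn_mem_FP _) (append_mem_FP hdd (PolyTimeComputable.id _))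
  have hdec : decF D ∈ FP := comp_mem_FP RenumDesc.renumF_mem_FP (fanoutFn_mem_FP hyard (fanoutFn_mem_FP prmF_mem_FP hbody))
  have hinv : invF D ∈ FP :=
    comp_mem_FP RenumDesc.renumF_mem_FP (fanoutFn_mem_FP hyard (fanoutFn_mem_FP prmF_mem_FP (comp_mem_FP InvCode.invCodeFn_mem_FP hbody)))
  have hanc : (fun z => fstF z ++ dUF D z) ∈ FP := append_mem_FP fstF_mem_FP hdU
  have hans : ansF D ∈ FP := iteFn_mem_FP (comp_mem_FP isNilFn_mem_FP hanc) (const_mem_FP _) (comp_mem_FP ansBitsF_mem_FP fstF_mem_FP)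
  have hcopy : (copyBitsF ∘ fstF) ∈ FP := comp_mem_FP copyBitsF_mem_FP fstF_mem_FP
  have h4 : (fun z => invF D z ++ (copyBitsF ∘ fstF) z) ∈ FP := append_mem_FP hinv hcopy
  have h3 : (fun z => ansF D z ++ (invF D z ++ (copyBitsF ∘ fstF) z)) ∈ FP := append_mem_FP hans h4
  have h2 : (fun z => decF D z ++ (ansF D z ++ (invF D z ++ (copyBitsF ∘ fstF) z))) ∈ FP := append_mem_FP hdec h3
  have h1 : (fun z => (copyBitsF ∘ fstF) z ++ (decF D z ++ (ansF D z ++ (invF D z ++ (copyBitsF ∘ fstF) z)))) ∈ FP := append_mem_FP hcopy h2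
  exact fanoutFn_mem_FP (comp_mem_FP lenBinF_mem_FP (comp_mem_FP (cons_mem_FP true) fstF_mem_FP)) (fanoutFn_mem_FP hanc h1)

/-! ### Values on the canonical input -/

section Values

variable (k r : ℕ)

/-- Shorthand: the canonical input. -/
local notation "w₀" => unaryPairEncode (k, r)

/-- `fstF` of the canonical input. [folklore] -/
theorem fstF_w : fstF w₀ = unaryEncodeNat k := by simp [unaryPairEncode]

/-- Its length. [folklore] -/
theorem length_fstF_w : (fstF w₀).length = k := by rw [fstF_w, DeciderFamily.length_unaryEncodeNat]

/-- `dUF` on the canonical input. [folklore] -/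
theorem dUF_apply : dUF D w₀ = unaryEncodeNat (D.anc k r) := by
  simp only [dUF, Function.comp_apply, DeciderFamily.ddF_apply, sndF_boolPair, fstF_boolPair]

/-- `bodyF` on the canonical input. [folklore] -/
theorem bodyF_apply : bodyF D w₀ = (D.circ k r).encode := by
  simp only [bodyF, Function.comp_apply, DeciderFamily.ddF_apply, sndF_boolPair]

/-- The ancilla count of the tidy block in unary. [folklore] -/
theorem anc_apply : fstF w₀ ++ dUF D w₀ = unaryEncodeNat (k + D.anc k r) := by
  rw [fstF_w, dUF_apply, RevDesc.unaryEncodeNat_eq_replicate, RevDesc.unaryEncodeNat_eq_replicate, RevDesc.unaryEncodeNat_eq_replicate,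
    List.replicate_add]

/-- `prmF` on the canonical input is the shift record. [folklore] -/
theorem prmF_apply : prmF w₀ = RenumDesc.prmOf [] (k + 1) := by
  simp only [prmF, fanoutFn_apply, Function.comp_apply, fstF_w, lenBinF_apply, List.length_cons, DeciderFamily.length_unaryEncodeNat,
    RenumDesc.prmOf, List.length_nil, List.map_nil, encList_nil]
  rw [show encodeNat 0 = [] from rfl]

/-- The yardstick is long. [folklore] -/
theorem length_yardF : (yardF D w₀).length = 8 * ((D.ddF w₀).length + (unaryPairEncode (k, r)).length) + 8 := by
  simp [yardF, ones]

/-- The description is at least as long as the circuit is large. [folklore] -/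
theorem size_le_ddF : (D.circ k r).size ≤ (D.ddF w₀).length := by
  rw [DeciderFamily.ddF_apply, length_boolPair, length_boolPair]
  have := QCircuit.size_le_length_encode (D.circ k r)
  omega

/-- The ancilla count is at most the description length. [folklore] -/
theorem anc_le_ddF : D.anc k r ≤ (D.ddF w₀).length := by
  rw [DeciderFamily.ddF_apply, length_boolPair, length_boolPair]
  have : (unaryEncodeNat (D.anc k r)).length = D.anc k r := Computability.unary_decode_encode_nat _
  omega

/-- `k` is at most the input length. [folklore] -/
theorem k_le_w : k ≤ (unaryPairEncode (k, r)).length := by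
  simp [unaryPairEncode, DeciderFamily.length_unaryEncodeNat]; omega

/-- The values of the decider's placement are the shift by `k + 1`. [folklore] -/
theorem dE_val (d : ℕ) (i : Fin (k + d)) : ((dE k d i : Fin (W k d)) : ℕ) = RenumDesc.wmap [] (k + 1) i := by
  rw [RenumDesc.wmap_nil, val_dE]

/-- **The transported decider describes as `decF`.** [cite: AroraBarak2009, §6.2 Remark 6.7] -/
theorem decF_apply : decF D w₀ = (mapWires (dE k (D.anc k r)) (D.circ k r)).encode := by
  rw [decF, Function.comp_apply, fanoutFn_apply, fanoutFn_apply, prmF_apply, bodyF_apply]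
  symm
  refine RenumDesc.encode_mapWires_eq_renumF _ [] (k + 1) (dE k (D.anc k r)) (dE_val k (D.anc k r)) (D.circ k r) ?_ ?_ ?_
  · rw [length_yardF]; have := size_le_ddF (D := D) k r; omega
  · rw [length_yardF]; have := anc_le_ddF (D := D) k r; have := k_le_w k r; omega
  · intro w hw; rw [length_yardF, RenumDesc.wmap_nil]; have := anc_le_ddF (D := D) k r; have := k_le_w k r; omega

/-- **The transported inverse decider describes as `invF`** (for an oracle-free decider). [cite: BennettBernsteinBrassardVazirani1997, Lemma 4.11 (reversal)] -/
theorem invF_apply (hfree : (D.circ k r).IsOracleFree) : invF D w₀ = (mapWires (dE k (D.anc k r)) (D.circ k r).inv).encode := by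
  rw [invF, Function.comp_apply, fanoutFn_apply, fanoutFn_apply, prmF_apply, Function.comp_apply, bodyF_apply,
    QCircuit.encode_eq_encList (D.circ k r), InvCode.invCodeFn_encList, ← encode_inv hfree]
  symm
  refine RenumDesc.encode_mapWires_eq_renumF _ [] (k + 1) (dE k (D.anc k r)) (dE_val k (D.anc k r)) (D.circ k r).inv ?_ ?_ ?_
  · rw [length_yardF]; have := size_le_ddF (D := D) k r; have := (D.circ k r).size_inv_le; omega
  · rw [length_yardF]; have := anc_le_ddF (D := D) k r; have := k_le_w k r; omega
  · intro w hw; rw [length_yardF, RenumDesc.wmap_nil]; have := anc_le_ddF (D := D) k r; have := k_le_w k r; omega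

/-- The copy CNOTs as `ℕ`-operations. [folklore] -/
def copyCl : List (ClOp ℕ) := (List.range k).map fun i => ClOp.cnot i (k + 1 + i)

/-- The compiled copy CNOTs of a list of query wires describe as `ℕ`-operations. [folklore] -/
theorem flatMap_gateEnc_copyOpsOf (d : ℕ) (l : List (Fin k)) :
    (revCompile (copyOpsOf (d := d) l)).flatMap gateEnc = (l.map fun i : Fin k => ClOp.cnot (i : ℕ) (k + 1 + i)).flatMap opBits := by
  induction l with
  | nil => rfl
  | cons i l ih =>
    have h1 : revCompile (copyOpsOf (d := d) (i :: l)) =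
        (RevOp.cnot (qW i) (dE k d (Fin.castAdd d i)) (TidyBlock.qW_ne_dE i _)).compile ++ revCompile (copyOpsOf (d := d) l) := rfl
    rw [h1, List.flatMap_append, ih, List.map_cons, List.flatMap_cons]
    congr 1
    simp [RevOp.compile, gateEnc_cnotOn, opBits, agates, AGate.bits, symCode, symArity, val_qW]

/-- **The compiled copy CNOTs describe as the `ℕ`-operations.** [cite: AroraBarak2009, §6.1 (descriptions of circuits)] -/
theorem flatMap_gateEnc_copyOps (d : ℕ) : (revCompile (TidyBlock.copyOps k d)).flatMap gateEnc = (copyCl k).flatMap opBits := by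
  rw [TidyBlock.copyOps, flatMap_gateEnc_copyOpsOf, copyCl, ← List.map_coe_finRange_eq_range, List.map_map]
  rfl

/-- `copyBitsF` prints the copy CNOTs. [folklore] -/
theorem copyBitsF_apply (u : List Bool) (d : ℕ) : copyBitsF u = (revCompile (TidyBlock.copyOps u.length d)).flatMap gateEnc := by
  rw [flatMap_gateEnc_copyOps, copyBitsF, genCopy]
  have hu : ∀ j, Function.update (GenProg.initEnv GV.uu u.length) GV.jj j GV.uu = u.length := fun j => by
    rw [Function.update_of_ne (by decide), GenProg.initEnv_self]
  simp only [GStmt.out, out_opsG, List.map_cons, List.map_nil, ClOp.map, GExpr.eval, Function.update_self, hu, GenProg.initEnv_self,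
    List.flatMap_cons, List.flatMap_nil, List.append_nil, copyCl]
  rw [show ((List.range u.length).flatMap fun j => opToks (ClOp.cnot j (u.length + 1 + j))) =
      ((List.range u.length).map fun i => ClOp.cnot i (u.length + 1 + i)).flatMap opToks by rw [List.flatMap_map],
    render_flatMap_opToks_nil]

/-- The answer CNOT as an `ℕ`-operation (present iff `0 < k + d`). [folklore] -/
theorem flatMap_gateEnc_ansOps (d : ℕ) :
    (revCompile (ansOps k d)).flatMap gateEnc = if 0 < k + d then opBits (ClOp.cnot (k + 1) k) else [] := by
  unfold ansOps revCompile
  split_ifs with h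
  · simp [RevOp.compile, gateEnc_cnotOn, opBits, agates, AGate.bits, symCode, symArity, val_bW]
  · rfl

/-- `ansBitsF` prints the answer CNOT. [folklore] -/
theorem ansBitsF_apply (u : List Bool) : ansBitsF u = opBits (ClOp.cnot (u.length + 1) u.length) := by
  rw [ansBitsF, genAns, out_opsG, List.map_cons, List.map_nil]
  simp only [ClOp.map, GExpr.eval, GenProg.initEnv_self]
  rw [render_flatMap_opToks_nil, List.flatMap_cons, List.flatMap_nil, List.append_nil]

/-- `ansF` on the canonical input. [folklore] -/
theorem ansF_apply : ansF D w₀ = (revCompile (ansOps k (D.anc k r))).flatMap gateEnc := by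
  rw [flatMap_gateEnc_ansOps]
  have hc : (isNilFn ∘ fun z => fstF z ++ dUF D z) w₀ = [decide (k + D.anc k r = 0)] := by
    rw [Function.comp_apply, anc_apply, isNilFn]
    simp [RevDesc.unaryEncodeNat_eq_replicate, List.replicate_eq_nil_iff]
  unfold ansF
  by_cases h : 0 < k + D.anc k r
  · rw [decide_eq_false (by omega)] at hc
    rw [iteFn_apply_false hc, if_pos h, Function.comp_apply, ansBitsF_apply, length_fstF_w]
  · rw [decide_eq_true (by omega)] at hc
    rw [iteFn_apply_true hc, if_neg h]

/-- **The description of the tidy block.** [cite: BennettBernsteinBrassardVazirani1997, Thm. 4.14 (proof: run, copy, reverse)] -/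
theorem encode_tidyCirc (C : QCircuit cliffordT (k + r)) :
    (tidyCirc C).encode = (revCompile (TidyBlock.copyOps k r)).flatMap gateEnc ++ ((mapWires (dE k r) C).encode ++
      ((revCompile (ansOps k r)).flatMap gateEnc ++ ((mapWires (dE k r) C.inv).encode ++ (revCompile (TidyBlock.copyOps k r)).flatMap gateEnc))) := by
  rw [tidyCirc, tidyGates, show QCircuit.encode (⟨revCompile (TidyBlock.copyOps k r) ++ ((mapWires (dE k r) C).gates ++ (revCompile (ansOps k r) ++
      ((mapWires (dE k r) C.inv).gates ++ revCompile (TidyBlock.copyOps k r))))⟩ : QCircuit cliffordT (W k r)) = _ from encode_eq_flatMap _,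
    show (mapWires (dE k r) C).encode = QCircuit.encode (⟨(mapWires (dE k r) C).gates⟩ : QCircuit cliffordT (W k r)) from rfl,
    show (mapWires (dE k r) C.inv).encode = QCircuit.encode (⟨(mapWires (dE k r) C.inv).gates⟩ : QCircuit cliffordT (W k r)) from rfl,
    encode_eq_flatMap, encode_eq_flatMap]
  simp only [List.flatMap_append]

/-- **`descF` on the canonical input is the description of the tidy block** (for an oracle-free
decider family). [folklore] -/
theorem descF_apply (hfree : D.IsOracleFree) :
    descF D w₀ = QCircuit.sigmaEncode (G := cliffordT) ⟨k + 1, k + D.anc k r, tidyCirc (D.circ k r)⟩ := by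
  rw [QCircuit.sigmaEncode_eq, descF, fanoutFn_apply, fanoutFn_apply, Function.comp_apply, Function.comp_apply, anc_apply, fstF_w,
    lenBinF_apply, List.length_cons, DeciderFamily.length_unaryEncodeNat, encode_tidyCirc, decF_apply, ansF_apply,
    invF_apply k r (hfree k r), copyBitsF_apply _ (D.anc k r), DeciderFamily.length_unaryEncodeNat]

end Values

end TidyUniform

/-- **The tidy family of a uniform oracle-free decider family is uniform in `⟨1^k, 1^r⟩`**
(Bennett–Bernstein–Brassard–Vazirani 1997, Thm. 4.14, the time bound: the tidy machine is the boosted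
machine run forth, a copy, and the boosted machine reversed — printed here gate by gate in polynomial
time). [cite: BennettBernsteinBrassardVazirani1997, Thm. 4.14 (time bound cT(n)) and Lemma 4.11] -/
theorem DeciderFamily.tidy_isUniform {D : DeciderFamily Cryptography.cliffordT} (hU : D.IsUniform) (hfree : D.IsOracleFree) :
    D.tidy.IsUniform :=
  PolyTimeComputable.of_encode (TidyUniform.descF_mem_FP hU) unaryPairEncode (fun _ => rfl) fun p => by
    obtain ⟨k, r⟩ := p
    exact TidyUniform.descF_apply k r hfree

end Literature.Computability.QuantumComplexity

/-! ## Part B — the substituted family is uniform -/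


namespace Literature.Computability.QuantumComplexity

open _root_.Computability Polynomial Complexity Complexity.Brick Plumb RevDesc Cryptography

/-! ### The two-parameter description function of a tidy family -/

namespace TidyFamily

variable (S : TidyFamily cliffordT)

/-- **The description function on all strings**: `z ↦ sigmaEncode ⟨k + 1, anc k r, circ k r⟩` with
`k = |fst z|`, `r = |snd z|`. [cite: AroraBarak2009, §6.2 (P-uniform circuit families)] -/
def ddF (z : List Bool) : List Bool :=
  QCircuit.sigmaEncode (G := cliffordT) ⟨(fstF z).length + 1, S.anc (fstF z).length (sndF z).length, S.circ (fstF z).length (sndF z).length⟩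

variable {S}

/-- **A uniform tidy family has an `FP` description function.** [cite: AroraBarak2009, §6.2 Def. 6.12 and Remark 6.7] -/
theorem ddF_mem_FP_of_isUniform (h : S.IsUniform) : S.ddF ∈ FP := by
  have hc := PolyTimeComputable.comp_holds h DeciderFamily.parse_polyTime
  exact PolyTimeComputable.of_encode (ea := fun x : List Bool => x) (eb := fun x : List Bool => x) (f := S.ddF) hc (fun z => z)
    (fun _ => rfl) (fun _ => rfl)

/-- `ddF` on the canonical input. [folklore] -/
theorem ddF_apply (k r : ℕ) : S.ddF (unaryPairEncode (k, r)) =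
    boolPair (encodeNat (k + 1)) (boolPair (unaryEncodeNat (S.anc k r)) (S.circ k r).encode) := by
  have hk : (fstF (unaryPairEncode (k, r))).length = k := by simp [unaryPairEncode, DeciderFamily.length_unaryEncodeNat]
  have hr : (sndF (unaryPairEncode (k, r))).length = r := by simp [unaryPairEncode, DeciderFamily.length_unaryEncodeNat]
  unfold ddF
  have key : ∀ m s, m = k → s = r → QCircuit.sigmaEncode (G := cliffordT) ⟨m + 1, S.anc m s, S.circ m s⟩ =
      boolPair (encodeNat (k + 1)) (boolPair (unaryEncodeNat (S.anc k r)) (S.circ k r).encode) := by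
    rintro m s rfl rfl; rfl
  exact key _ _ hk hr

/-- `unaryPairEncode` from `ones`. [folklore] -/
theorem boolPair_ones_eq (k r : ℕ) : boolPair (ones k) (ones r) = unaryPairEncode (k, r) := by
  simp [unaryPairEncode, ones, RevDesc.unaryEncodeNat_eq_replicate]

end TidyFamily

namespace SubstUniform

/-! ### Gate codes under placements on the first wires -/

/-- Placing a gate on the first wires of a wider register does not change its code. [folklore] -/
theorem encode_mapWiresGate_castLE {G : QGateSet} [Encodable G.Op] {N W : ℕ} (h : N ≤ W) (g : QGate G N) :
    (mapWiresGate (Fin.castLEEmb h) g).encode = g.encode := by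
  cases g <;> rfl

/-- **The values of a block placement**: the table of the query/answer wires, then the shift.
[folklore] -/
theorem blockEmb_val {k N W : ℕ} (e : Fin (k + 1) ↪ Fin N) (off a : ℕ) (hN : N ≤ off) (hW : off + a ≤ W) (i : Fin (k + 1 + a)) :
    ((OracleImpl.blockEmb e off a hN hW i : Fin W) : ℕ) = RenumDesc.wmap (List.ofFn fun j : Fin (k + 1) => (e j : ℕ)) off i := by
  rw [OracleImpl.blockEmb_apply]
  induction i using Fin.addCases with
  | left j =>
    rw [OracleImpl.blockMap_castAdd, RenumDesc.wmap_of_lt off (by rw [List.length_ofFn]; exact j.isLt)]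
    simp only [Fin.val_castAdd, List.getElem_ofFn, Fin.eta]
  | right j =>
    rw [OracleImpl.blockMap_natAdd, RenumDesc.wmap_of_le off (by rw [List.length_ofFn, Fin.val_natAdd]; exact Nat.le_add_right _ _)]
    rw [List.length_ofFn, Fin.val_natAdd, Nat.add_sub_cancel_left]

/-! ### The string-level state and the loop body -/

section Body

variable (S : TidyFamily cliffordT)

/-- The yardstick, from the loop record `z = ⟨⟨yard, qU⟩, ⟨cnt, state⟩⟩`. [folklore] -/
def yardOf : List Bool → List Bool := fstF ∘ nthF 0
/-- `1^{q n}`, from the loop record. [folklore] -/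
def qUOf : List Bool → List Bool := sndF ∘ nthF 0
/-- The remaining codes. [folklore] -/
def restOf : List Bool → List Bool := nthF 2
/-- The offset, in binary. [folklore] -/
def offOf : List Bool → List Bool := nthF 3
/-- The emitted codes. [folklore] -/
def accOf : List Bool → List Bool := sndPow 3
/-- The head code. [folklore] -/
def codeOf : List Bool → List Bool := fstF ∘ restOf
/-- The head code without its tag bit. [folklore] -/
def cbodyOf : List Bool → List Bool := dropFn ∘ fanoutFn (fun _ => [true]) codeOf
/-- The query length of an oracle code, in binary. [folklore] -/
def knumOf : List Bool → List Bool := fstF ∘ cbodyOf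
/-- The unary arity field of the code. [folklore] -/
def ulenOf : List Bool → List Bool := nthF 1 ∘ cbodyOf
/-- The wire list of the code (the table). [folklore] -/
def wlOf : List Bool → List Bool := sndPow 1 ∘ cbodyOf
/-- The query length in unary (capped by the yardstick). [folklore] -/
def kuOf : List Bool → List Bool := binToUnaryFn ∘ fanoutFn yardOf knumOf
/-- The description of the block `S.circ k (q n)`. [folklore] -/
def blkOf : List Bool → List Bool := S.ddF ∘ fanoutFn kuOf qUOf
/-- Its ancilla count in unary. [folklore] -/
def aUOf : List Bool → List Bool := nthF 1 ∘ blkOf S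
/-- Its gate codes. [folklore] -/
def bdescOf : List Bool → List Bool := sndPow 1 ∘ blkOf S
/-- The renumbering parameters `⟨bin (k+1), ⟨table, offset⟩⟩`. [folklore] -/
def prmOfF : List Bool → List Bool := fanoutFn (lenBinF ∘ ulenOf) (fanoutFn wlOf offOf)
/-- The renumbered block codes. [folklore] -/
def renOf : List Bool → List Bool := RenumDesc.renumF ∘ fanoutFn yardOf (fanoutFn (prmOfF) (bdescOf S))

/-- **The oracle branch**: pop the code, advance the offset, emit the renumbered block.
[cite: BennettBernsteinBrassardVazirani1997, Cor. 4.15 (replace each oracle call by a tidy machine)] -/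
def oracleB : List Bool → List Bool :=
  fanoutFn (sndF ∘ restOf) (fanoutFn (addFn ∘ fanoutFn offOf (lenBinF ∘ aUOf S)) (fun z => accOf z ++ renOf S z))

/-- The head code as a one-item list `⟨c, []⟩`. [folklore] -/
def itemOf : List Bool → List Bool := fanoutFn codeOf (fun _ => [])

/-- **The gate branch**: pop the code and emit it verbatim (as an item). [folklore] -/
def gateB : List Bool → List Bool :=
  fanoutFn (sndF ∘ restOf) (fanoutFn offOf (fun z => accOf z ++ itemOf z))

/-- The tag bit of the head code (`0` for an absent code). [folklore] -/
def tagOf : List Bool → List Bool := takeFn ∘ fanoutFn (fun _ => [true]) ((fun c => c ++ [false]) ∘ codeOf)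

/-- The body on a nonempty remaining list. [folklore] -/
def realBody : List Bool → List Bool := iteFn tagOf (oracleB S) (gateB)

/-- **The loop body** (idle when no code remains). [cite: AroraBarak2009, §1.3 (bounded loops)] -/
def body : List Bool → List Bool := iteFn (isNilFn ∘ restOf) (sndPow 1) (realBody S)

variable {S}

/-- `tagOf` is one-bit. [folklore] -/
theorem oneBit_tagOf : OneBit tagOf := fun z => by
  refine ⟨(codeOf z ++ [false]).headD false, ?_⟩
  simp only [tagOf, Function.comp_apply, fanoutFn_apply, takeFn_boolPair, List.length_singleton]
  cases codeOf z <;> rfl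

/-- `tagOf` reads the first bit of the head code. [folklore] -/
theorem tagOf_eq (z : List Bool) : tagOf z = [(codeOf z).headD false] := by
  simp only [tagOf, Function.comp_apply, fanoutFn_apply, takeFn_boolPair, List.length_singleton]
  cases codeOf z <;> rfl

/-! ### Membership in `FP` and growth -/

section FP

variable (pS : Polynomial ℕ) (hpS : ∀ w, (S.ddF w).length ≤ pS.eval w.length)

omit hpS in
/-- All the field accessors are in `FP`. [folklore] -/
theorem accessors_mem_FP :
    yardOf ∈ FP ∧ qUOf ∈ FP ∧ restOf ∈ FP ∧ offOf ∈ FP ∧ accOf ∈ FP ∧ codeOf ∈ FP ∧ cbodyOf ∈ FP ∧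
      knumOf ∈ FP ∧ ulenOf ∈ FP ∧ wlOf ∈ FP ∧ kuOf ∈ FP := by
  have hy : yardOf ∈ FP := comp_mem_FP fstF_mem_FP (nthF_mem_FP 0)
  have hq : qUOf ∈ FP := comp_mem_FP sndF_mem_FP (nthF_mem_FP 0)
  have hr : restOf ∈ FP := nthF_mem_FP 2
  have hc : codeOf ∈ FP := comp_mem_FP fstF_mem_FP hr
  have hb : cbodyOf ∈ FP := comp_mem_FP dropFn_mem_FP (fanoutFn_mem_FP (const_mem_FP _) hc)
  have hk : knumOf ∈ FP := comp_mem_FP fstF_mem_FP hb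
  exact ⟨hy, hq, hr, nthF_mem_FP 3, sndPow_mem_FP 3, hc, hb, hk, comp_mem_FP (nthF_mem_FP 1) hb, comp_mem_FP (sndPow_mem_FP 1) hb,
    comp_mem_FP binToUnaryFn_mem_FP (fanoutFn_mem_FP hy hk)⟩

omit hpS in
/-- **`body ∈ FP`** for a uniform `S`. [cite: AroraBarak2009, §1.3] -/
theorem body_mem_FP (hU : S.IsUniform) : body S ∈ FP := by
  obtain ⟨hy, hq, hr, ho, ha, hc, _, _, hul, hwl, hku⟩ := accessors_mem_FP
  have hblk : blkOf S ∈ FP := comp_mem_FP (TidyFamily.ddF_mem_FP_of_isUniform hU) (fanoutFn_mem_FP hku hq)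
  have haU : aUOf S ∈ FP := comp_mem_FP (nthF_mem_FP 1) hblk
  have hbd : bdescOf S ∈ FP := comp_mem_FP (sndPow_mem_FP 1) hblk
  have hprm : prmOfF ∈ FP := fanoutFn_mem_FP (comp_mem_FP lenBinF_mem_FP hul) (fanoutFn_mem_FP hwl ho)
  have hren : renOf S ∈ FP := comp_mem_FP RenumDesc.renumF_mem_FP (fanoutFn_mem_FP hy (fanoutFn_mem_FP hprm hbd))
  have hor : oracleB S ∈ FP := fanoutFn_mem_FP (comp_mem_FP sndF_mem_FP hr)
    (fanoutFn_mem_FP (comp_mem_FP addFn_mem_FP (fanoutFn_mem_FP ho (comp_mem_FP lenBinF_mem_FP haU))) (append_mem_FP ha hren))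
  have hit : itemOf ∈ FP := fanoutFn_mem_FP hc (const_mem_FP _)
  have hitem : (fun z => accOf z ++ itemOf z) ∈ FP := append_mem_FP ha hit
  have hga : gateB ∈ FP := fanoutFn_mem_FP (comp_mem_FP sndF_mem_FP hr) (fanoutFn_mem_FP ho hitem)
  have hsnoc : (fun c : List Bool => c ++ [false]) ∈ FP := append_mem_FP (f := fun c : List Bool => c) (g := fun _ => [false]) (PolyTimeComputable.id _) (const_mem_FP _)
  have htag : tagOf ∈ FP := comp_mem_FP takeFn_mem_FP (fanoutFn_mem_FP (const_mem_FP _) (comp_mem_FP hsnoc hc))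
  exact iteFn_mem_FP (comp_mem_FP isNilFn_mem_FP hr) (sndPow_mem_FP 1) (iteFn_mem_FP htag hor hga)

/-- The growth polynomial of the body (in the context length). [folklore] -/
def bodyPoly (pS : Polynomial ℕ) : Polynomial ℕ :=
  C 4 * pS.comp (C 3 * X + C 2) + X * (C 2 * RenumDesc.codePoly + C 4) + C 12

/-- `renOf` is a `mapLF` over the block codes. [folklore] -/
theorem renOf_eq (z : List Bool) : renOf S z =
    mapLF RenumDesc.codeF (boolPair (yardOf z) (boolPair (encodeNat (yardOf z).length) (boolPair (prmOfF z) (bdescOf S z)))) := by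
  simp only [renOf, RenumDesc.renumF, Function.comp_apply, fanoutFn_apply, nthF_zero_boolPair, lenBinF_apply, nthF_succ_boolPair,
    sndPow_succ_boolPair, sndPow_zero_boolPair]

include hpS in
/-- **Growth of the body**: the state grows by at most `bodyPoly pS (|x|)` per round, on every input.
[folklore] -/
theorem length_body_le (z : List Bool) : (body S z).length ≤ (sndPow 1 z).length + (bodyPoly pS).eval (fstF z).length := by
  have hP : (bodyPoly pS).eval (fstF z).length =
      4 * pS.eval (3 * (fstF z).length + 2) + (fstF z).length * (2 * RenumDesc.codePoly.eval (fstF z).length + 4) + 12 := by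
    simp [bodyPoly]
  -- structural inequalities of the record (`restOf = nthF 2`, `offOf = nthF 3`, `accOf = sndPow 3`)
  have h2 : 2 * (restOf z).length + (sndPow 2 z).length ≤ (sndPow 1 z).length := length_nthF_succ_add_sndPow_succ_le 1 z
  have h3 : 2 * (offOf z).length + (accOf z).length ≤ (sndPow 2 z).length := length_nthF_succ_add_sndPow_succ_le 2 z
  have hx : 2 * (yardOf z).length + (qUOf z).length ≤ (nthF 0 z).length := length_fstF_sndF_le (nthF 0 z)
  have hx0 : (nthF 0 z).length = (fstF z).length := by rw [nthF_zero]
  have hrest : 2 * (codeOf z).length + (sndF (restOf z)).length ≤ (restOf z).length := length_fstF_sndF_le (restOf z)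
  rw [body, iteFn_of_oneBit (oneBit_isNilFn.comp _)]
  split_ifs with hnil
  · omega
  rw [realBody, iteFn_of_oneBit oneBit_tagOf]
  split_ifs with htag
  · -- oracle branch
    have hku : (kuOf z).length ≤ (yardOf z).length := by
      have e : kuOf z = binToUnaryFn (boolPair (yardOf z) (knumOf z)) := by rw [kuOf, Function.comp_apply, fanoutFn_apply]
      rw [e]; exact length_binToUnaryFn_boolPair_le _ _
    have hblk : (blkOf S z).length ≤ pS.eval (3 * (fstF z).length + 2) := by
      have e : blkOf S z = S.ddF (boolPair (kuOf z) (qUOf z)) := by rw [blkOf, Function.comp_apply, fanoutFn_apply]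
      rw [e]
      refine (hpS _).trans (TM2Iter.eval_mono pS ?_)
      rw [length_boolPair]; omega
    have haU : (aUOf S z).length ≤ (blkOf S z).length := length_nthF_le 1 (blkOf S z)
    have hbd : (bdescOf S z).length ≤ (blkOf S z).length := length_sndPow_le 1 (blkOf S z)
    have hren : (renOf S z).length ≤ 2 * (bdescOf S z).length + (fstF z).length * (2 * RenumDesc.codePoly.eval (fstF z).length + 4) := by
      rw [renOf_eq]
      have h := length_mapLF_le (f := RenumDesc.codeF) 2 RenumDesc.length_codeF_le
        (boolPair (yardOf z) (boolPair (encodeNat (yardOf z).length) (boolPair (prmOfF z) (bdescOf S z))))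
      rw [fstF_boolPair, sndPow_succ_boolPair, sndPow_succ_boolPair, sndPow_zero_boolPair] at h
      refine h.trans (Nat.add_le_add_left (Nat.mul_le_mul (by omega) ?_) _)
      have hm := TM2Iter.eval_mono RenumDesc.codePoly (show (yardOf z).length ≤ (fstF z).length by omega)
      omega
    have hl : (lenBinF (aUOf S z)).length ≤ (aUOf S z).length := by
      rw [lenBinF_apply]; exact Complexity.length_encodeNat_le_self _
    have hoff : (addFn (boolPair (offOf z) (lenBinF (aUOf S z)))).length ≤ (offOf z).length + (aUOf S z).length + 1 := by
      have h := length_addFn_le (boolPair (offOf z) (lenBinF (aUOf S z)))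
      rw [fstF_boolPair, sndF_boolPair] at h
      omega
    have e : oracleB S z = boolPair (sndF (restOf z)) (boolPair (addFn (boolPair (offOf z) (lenBinF (aUOf S z)))) (accOf z ++ renOf S z)) := by
      simp only [oracleB, fanoutFn_apply, Function.comp_apply]
    rw [e, length_boolPair, length_boolPair, List.length_append, hP]
    omega
  · -- gate branch
    have e : gateB z = boolPair (sndF (restOf z)) (boolPair (offOf z) (accOf z ++ boolPair (codeOf z) [])) := by
      simp only [gateB, itemOf, fanoutFn_apply, Function.comp_apply]
    rw [e, length_boolPair, length_boolPair, List.length_append, length_boolPair, List.length_nil, hP]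
    omega

end FP

/-! ### Values of the body on well-formed records -/

/-- `encList` of an append. [folklore] -/
theorem encList_append (L M : List (List Bool)) : encList (L ++ M) = encList L ++ encList M := by
  simp [Com.encList_eq_flatMap]

/-- A one-item list. [folklore] -/
theorem boolPair_nil_eq_encList (c : List Bool) : boolPair c [] = encList [c] := by
  rw [encList_cons, encList_nil]

/-- The string-level state of the loop: the remaining codes, the offset, the emitted codes. [folklore] -/
def stateStr {N : ℕ} (gs : List (QGate cliffordT N)) (off : ℕ) (acc : List (List Bool)) : List Bool :=
  boolPair (encList (gs.map QGate.encode)) (boolPair (encodeNat off) (encList acc))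

/-- The loop record. [folklore] -/
def recStr (yard qU cnt st : List Bool) : List Bool := boolPair (boolPair yard qU) (boolPair cnt st)

section Values

variable {N : ℕ} (yard qU cnt : List Bool)

/-- Field values on a well-formed record. [folklore] -/
theorem fields_recStr (gs : List (QGate cliffordT N)) (off : ℕ) (acc : List (List Bool)) :
    yardOf (recStr yard qU cnt (stateStr gs off acc)) = yard ∧ qUOf (recStr yard qU cnt (stateStr gs off acc)) = qU ∧
    restOf (recStr yard qU cnt (stateStr gs off acc)) = encList (gs.map QGate.encode) ∧
    offOf (recStr yard qU cnt (stateStr gs off acc)) = encodeNat off ∧ accOf (recStr yard qU cnt (stateStr gs off acc)) = encList acc := by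
  simp only [yardOf, qUOf, restOf, offOf, accOf, recStr, stateStr, Function.comp_apply, nthF_zero_boolPair, fstF_boolPair, sndF_boolPair,
    nthF_succ_boolPair, sndPow_succ_boolPair, sndPow_zero_boolPair, and_self]

/-- **The body idles when no code remains.** [folklore] -/
theorem body_nil (off : ℕ) (acc : List (List Bool)) :
    body S (recStr yard qU cnt (stateStr ([] : List (QGate cliffordT N)) off acc)) = stateStr ([] : List (QGate cliffordT N)) off acc := by
  obtain ⟨-, -, hr, -, -⟩ := fields_recStr yard qU cnt ([] : List (QGate cliffordT N)) off acc
  have hc : (isNilFn ∘ restOf) (recStr yard qU cnt (stateStr ([] : List (QGate cliffordT N)) off acc)) = [true] := by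
    rw [Function.comp_apply, hr]; rfl
  rw [body, iteFn_apply_true hc]
  simp only [recStr, sndPow_succ_boolPair, sndPow_zero_boolPair]

/-- The head code and the tag on a nonempty remaining list. [folklore] -/
theorem codeOf_cons (g : QGate cliffordT N) (gs : List (QGate cliffordT N)) (off : ℕ) (acc : List (List Bool)) :
    codeOf (recStr yard qU cnt (stateStr (g :: gs) off acc)) = g.encode := by
  obtain ⟨-, -, hr, -, -⟩ := fields_recStr yard qU cnt (g :: gs) off acc
  rw [codeOf, Function.comp_apply, hr, List.map_cons, encList_cons, fstF_boolPair]

/-- **The body on a gate code**: pop and emit verbatim. [folklore] -/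
theorem body_gate (s : cliffordT.Op) (e : Fin (cliffordT.arity s) ↪ Fin N) (gs : List (QGate cliffordT N)) (off : ℕ) (acc : List (List Bool)) :
    body S (recStr yard qU cnt (stateStr (QGate.gate s e :: gs) off acc)) = stateStr gs off (acc ++ [(QGate.gate s e).encode]) := by
  obtain ⟨-, -, hr, ho, ha⟩ := fields_recStr yard qU cnt (QGate.gate s e :: gs) off acc
  have hcode := codeOf_cons yard qU cnt (QGate.gate s e) gs off acc
  have hc : (isNilFn ∘ restOf) (recStr yard qU cnt (stateStr (QGate.gate s e :: gs) off acc)) = [false] := by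
    rw [Function.comp_apply, hr, List.map_cons, encList_cons, isNilFn_boolPair]
  have ht : tagOf (recStr yard qU cnt (stateStr (QGate.gate s e :: gs) off acc)) = [false] := by
    rw [tagOf_eq, hcode]; rfl
  rw [body, iteFn_apply_false hc, realBody, iteFn_apply_false ht, gateB, fanoutFn_apply, fanoutFn_apply, Function.comp_apply, hr, ho, itemOf,
    fanoutFn_apply, ha, hcode, List.map_cons, encList_cons, sndF_boolPair, stateStr, encList_append, boolPair_nil_eq_encList]

variable (S)

/-- **The body on an oracle code**: pop, advance the offset by the block's ancilla count, emit the
renumbered codes of the block — provided the yardstick is long enough and `qU = 1^{r}`.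
[cite: BennettBernsteinBrassardVazirani1997, Cor. 4.15 (replace each oracle call by a tidy machine)] -/
theorem body_oracle (r : ℕ) {k : ℕ} (e : Fin (k + 1) ↪ Fin N) (gs : List (QGate cliffordT N)) (off : ℕ) (acc : List (List Bool))
    {W : ℕ} (hN : N ≤ off) (hW : off + (S.fix r).anc k ≤ W)
    (hk : k ≤ yard.length) (hsize : (S.circ k r).size ≤ yard.length) (hwidth : k + 1 + S.anc k r ≤ yard.length)
    (hv : ∀ w, w < k + 1 + S.anc k r → RenumDesc.wmap (List.ofFn fun j : Fin (k + 1) => (e j : ℕ)) off w ≤ yard.length) :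
    body S (recStr yard (ones r) cnt (stateStr (QGate.oracle k e :: gs) off acc)) =
      stateStr gs (off + S.anc k r) (acc ++ ((S.circ k r).gates.map (mapWiresGate (OracleImpl.blockEmb e off ((S.fix r).anc k) hN hW))).map QGate.encode) := by
  suffices key : ∀ z, z = recStr yard (ones r) cnt (stateStr (QGate.oracle k e :: gs) off acc) → body S z =
      stateStr gs (off + S.anc k r) (acc ++ ((S.circ k r).gates.map (mapWiresGate (OracleImpl.blockEmb e off ((S.fix r).anc k) hN hW))).map QGate.encode) from
    key _ rfl
  intro z hz
  obtain ⟨hy, hq, hr, ho, ha⟩ : yardOf z = yard ∧ qUOf z = ones r ∧ restOf z = encList ((QGate.oracle k e :: gs).map QGate.encode) ∧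
      offOf z = encodeNat off ∧ accOf z = encList acc := by
    rw [hz]; exact fields_recStr yard (ones r) cnt (QGate.oracle k e :: gs) off acc
  have hcode : codeOf z = (QGate.oracle k e : QGate cliffordT N).encode := by rw [hz]; exact codeOf_cons yard (ones r) cnt (QGate.oracle k e) gs off acc
  have hc : (isNilFn ∘ restOf) z = [false] := by
    rw [Function.comp_apply, hr, List.map_cons, encList_cons, isNilFn_boolPair]
  have ht : tagOf z = [true] := by rw [tagOf_eq, hcode]; rfl
  -- the parts of the oracle code
  have henc : (QGate.oracle k e : QGate cliffordT N).encode =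
      true :: boolPair (encodeNat k) (boolPair (unaryEncodeNat (k + 1)) (encList ((List.ofFn fun j : Fin (k + 1) => (e j : ℕ)).map encodeNat))) := by
    rw [RenumDesc.encode_eq_parts]
    simp [RenumDesc.parts]
  have hcb : cbodyOf z = boolPair (encodeNat k) (boolPair (unaryEncodeNat (k + 1)) (encList ((List.ofFn fun j : Fin (k + 1) => (e j : ℕ)).map encodeNat))) := by
    rw [cbodyOf, Function.comp_apply, fanoutFn_apply, hcode, henc, dropFn_boolPair, List.length_singleton, List.drop_succ_cons, List.drop_zero]
  have hkn : knumOf z = encodeNat k := by rw [knumOf, Function.comp_apply, hcb, fstF_boolPair]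
  have hul : ulenOf z = unaryEncodeNat (k + 1) := by rw [ulenOf, Function.comp_apply, hcb, nthF_succ_boolPair, nthF_zero_boolPair]
  have hwl : wlOf z = encList ((List.ofFn fun j : Fin (k + 1) => (e j : ℕ)).map encodeNat) := by
    rw [wlOf, Function.comp_apply, hcb, sndPow_succ_boolPair, sndPow_zero_boolPair]
  have hku : kuOf z = ones k := by
    rw [kuOf, Function.comp_apply, fanoutFn_apply, hy, hkn, binToUnaryFn_boolPair, bitsToNat_encodeNat, Nat.min_eq_left hk]
  have hblk : blkOf S z = boolPair (encodeNat (k + 1)) (boolPair (unaryEncodeNat (S.anc k r)) (S.circ k r).encode) := by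
    rw [blkOf, Function.comp_apply, fanoutFn_apply, hku, hq, TidyFamily.boolPair_ones_eq, TidyFamily.ddF_apply]
  have haU : aUOf S z = unaryEncodeNat (S.anc k r) := by rw [aUOf, Function.comp_apply, hblk, nthF_succ_boolPair, nthF_zero_boolPair]
  have hbd : bdescOf S z = (S.circ k r).encode := by rw [bdescOf, Function.comp_apply, hblk, sndPow_succ_boolPair, sndPow_zero_boolPair]
  have hlenu : (unaryEncodeNat (k + 1)).length = k + 1 := DeciderFamily.length_unaryEncodeNat _
  have hprm : prmOfF z = RenumDesc.prmOf (List.ofFn fun j : Fin (k + 1) => (e j : ℕ)) off := by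
    rw [prmOfF, fanoutFn_apply, fanoutFn_apply, Function.comp_apply, hul, lenBinF_apply, hlenu, hwl, ho, RenumDesc.prmOf, List.length_ofFn]
  have hren : renOf S z = encList (((S.circ k r).gates.map (mapWiresGate (OracleImpl.blockEmb e off ((S.fix r).anc k) hN hW))).map QGate.encode) := by
    rw [renOf, Function.comp_apply, fanoutFn_apply, fanoutFn_apply, hy, hprm, hbd, QCircuit.encode_eq_encList]
    exact RenumDesc.renumF_apply yard _ off (OracleImpl.blockEmb e off ((S.fix r).anc k) hN hW) (blockEmb_val e off _ hN hW)
      (S.circ k r).gates hsize hwidth hv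
  have hoffU : (lenBinF ∘ aUOf S) z = encodeNat (S.anc k r) := by
    rw [Function.comp_apply, haU, lenBinF_apply, DeciderFamily.length_unaryEncodeNat]
  rw [body, iteFn_apply_false hc, realBody, iteFn_apply_true ht, oracleB, fanoutFn_apply, fanoutFn_apply, Function.comp_apply, hr,
    Function.comp_apply, fanoutFn_apply, ho, hoffU, addFn_boolPair, bitsToNat_encodeNat, bitsToNat_encodeNat, ha, hren, List.map_cons,
    encList_cons, sndF_boolPair, stateStr, encList_append]

end Values

end Body

/-! ### The run of the loop over the gate list -/

section Run

variable (F : QCircuitFamily cliffordT) (S : TidyFamily cliffordT) (q : Polynomial ℕ)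

/-- The blocks at input length `n`. [folklore] -/
def B (n : ℕ) : OracleImpl cliffordT := S.fix (q.eval n)

variable {F S q}

/-- A bound on the ancilla counts of the blocks met along a gate list. [folklore] -/
def AncBound (S : TidyFamily cliffordT) (r M : ℕ) {N : ℕ} (gs : List (QGate cliffordT N)) : Prop :=
  ∀ g ∈ gs, ∀ k (e : Fin (k + 1) ↪ Fin N), g = QGate.oracle k e → (S.circ k r).size ≤ M ∧ k + 1 + S.anc k r ≤ M

/-- **The run of the loop**: `m ≥ |gs|` rounds from the state of `gs` at offset `off` end in the state
of `[]` at offset `off + extra` with the codes of `substGates` appended — under the invariant of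
`OracleImpl.substGates` (`N ≤ off`, `off + extra ≤ W`) and a yardstick longer than `W` and than the
bound `M` of the blocks. [cite: BennettBernsteinBrassardVazirani1997, Cor. 4.15] -/
theorem loopModel_run (r : ℕ) (yard cnt : List Bool) {N W : ℕ} (hNW : N ≤ W) (M : ℕ)
    (hW : W ≤ yard.length) (hM : M ≤ yard.length) :
    ∀ (gs : List (QGate cliffordT N)) (m : ℕ) (off : ℕ) (acc : List (List Bool)), gs.length ≤ m → N ≤ off →
      off + (S.fix r).extra gs ≤ W → AncBound S r M gs →
      loopModel (body S) (boolPair yard (ones r)) m (stateStr gs off acc) =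
        stateStr ([] : List (QGate cliffordT N)) (off + (S.fix r).extra gs)
          (acc ++ (OracleImpl.substGates (S.fix r) hNW off gs).map QGate.encode)
  | [], 0, off, acc, _, _, _, _ => by simp [loopModel, OracleImpl.extra, OracleImpl.substGates]
  | [], m + 1, off, acc, _, hoff, hfit, hb => by
    rw [loopModel, show boolPair (boolPair yard (ones r)) (boolPair (encodeNat (m + 1)) (stateStr ([] : List (QGate cliffordT N)) off acc)) =
        recStr yard (ones r) (encodeNat (m + 1)) (stateStr ([] : List (QGate cliffordT N)) off acc) from rfl, body_nil]
    exact loopModel_run r yard cnt hNW M hW hM [] m off acc (Nat.zero_le _) hoff hfit hb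
  | g :: gs, 0, off, acc, hlen, _, _, _ => by simp at hlen
  | QGate.gate s e :: gs, m + 1, off, acc, hlen, hoff, hfit, hb => by
    have hex : (S.fix r).extra (QGate.gate s e :: gs) = (S.fix r).extra gs := rfl
    have hsg : OracleImpl.substGates (S.fix r) hNW off (QGate.gate s e :: gs) =
        mapWiresGate (Fin.castLEEmb hNW) (QGate.gate s e) :: OracleImpl.substGates (S.fix r) hNW off gs := rfl
    rw [hex] at hfit ⊢
    have hb' : AncBound S r M gs := fun g hg => hb g (List.mem_cons_of_mem _ hg)
    rw [loopModel, show boolPair (boolPair yard (ones r)) (boolPair (encodeNat (m + 1)) (stateStr (QGate.gate s e :: gs) off acc)) =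
        recStr yard (ones r) (encodeNat (m + 1)) (stateStr (QGate.gate s e :: gs) off acc) from rfl, body_gate,
      loopModel_run r yard cnt hNW M hW hM gs m off _ (by simpa using hlen) hoff hfit hb', List.append_assoc, hsg, List.map_cons,
      encode_mapWiresGate_castLE]
    rfl
  | QGate.oracle k e :: gs, m + 1, off, acc, hlen, hoff, hfit, hb => by
    have hanc : (S.fix r).anc k = S.anc k r := rfl
    have hex : (S.fix r).extra (QGate.oracle k e :: gs) = S.anc k r + (S.fix r).extra gs := rfl
    rw [hex] at hfit ⊢
    have hfitk : N ≤ off ∧ off + (S.fix r).anc k ≤ W := ⟨hoff, by rw [hanc]; omega⟩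
    have hsg : OracleImpl.substGates (S.fix r) hNW off (QGate.oracle k e :: gs) =
        (mapWires (OracleImpl.blockEmb e off ((S.fix r).anc k) hfitk.1 hfitk.2) ((S.fix r).circ k)).gates ++
          OracleImpl.substGates (S.fix r) hNW (off + (S.fix r).anc k) gs := by
      rw [OracleImpl.substGates, dif_pos hfitk]
    have hb' : AncBound S r M gs := fun g hg => hb g (List.mem_cons_of_mem _ hg)
    obtain ⟨hsizeM, hwidthM⟩ := hb _ (List.mem_cons_self ..) k e rfl
    have hk : k ≤ yard.length := by omega
    have hv : ∀ w, w < k + 1 + S.anc k r → RenumDesc.wmap (List.ofFn fun j : Fin (k + 1) => (e j : ℕ)) off w ≤ yard.length := by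
      intro w hw
      by_cases hlt : w < k + 1
      · rw [RenumDesc.wmap_of_lt off (by simpa using hlt)]
        have : (List.ofFn fun j : Fin (k + 1) => (e j : ℕ))[w]'(by simpa using hlt) < N := by
          rw [List.getElem_ofFn]; exact (e _).isLt
        omega
      · rw [RenumDesc.wmap_of_le off (by simpa using Nat.not_lt.1 hlt), List.length_ofFn]
        omega
    rw [loopModel, show boolPair (boolPair yard (ones r)) (boolPair (encodeNat (m + 1)) (stateStr (QGate.oracle k e :: gs) off acc)) =
        recStr yard (ones r) (encodeNat (m + 1)) (stateStr (QGate.oracle k e :: gs) off acc) from rfl,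
      body_oracle S yard (encodeNat (m + 1)) r e gs off acc hfitk.1 hfitk.2 hk (hsizeM.trans hM) (hwidthM.trans hM) hv,
      loopModel_run r yard cnt hNW M hW hM gs m (off + S.anc k r) _ (by simpa using hlen) (by omega) (by omega) hb',
      List.append_assoc, hsg, List.map_append, Nat.add_assoc]
    rfl

end Run

/-! ### The description function -/

section Desc

variable (F : QCircuitFamily cliffordT) (S : TidyFamily cliffordT) (q Py : Polynomial ℕ)

/-- The context `⟨yardstick, 1^{q n}⟩` from `z` (`n = |z|`). [folklore] -/
def ctxF : List Bool → List Bool := fanoutFn (polyFn Py) (polyFn q)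

/-- `bin (n + F.ancillas n)`. [folklore] -/
def NbinF : List Bool → List Bool := addFn ∘ fanoutFn lenBinF (lenBinF ∘ fstF ∘ sndF ∘ F.descFn)

/-- The gate codes of `F.circ n`. [folklore] -/
def codesF : List Bool → List Bool := sndF ∘ sndF ∘ F.descFn

/-- The initial loop record. [folklore] -/
def initF : List Bool → List Bool :=
  fanoutFn (ctxF q Py) (fanoutFn (lenBinF ∘ ctxF q Py) (fanoutFn (codesF F) (fanoutFn (NbinF F) (fun _ => []))))

/-- The loop: `|x|` rounds. [cite: AroraBarak2009, §1.3 (bounded loops)] -/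
def loopF : List Bool → List Bool := fun z => (loopStep (body S))^[(X : Polynomial ℕ).eval (fstF z).length] z

/-- The final record. [folklore] -/
def resF : List Bool → List Bool := loopF S ∘ initF F q Py

/-- The number of fresh wires in unary. [folklore] -/
def extraUF : List Bool → List Bool := binToUnaryFn ∘ fanoutFn (polyFn Py) (subFn ∘ fanoutFn (nthF 3 ∘ resF F S q Py) (NbinF F))

/-- **The description of the substituted family** as a string function. [cite: AroraBarak2009, §6.2 Def. 6.12 and Remark 6.7] -/
def descF : List Bool → List Bool :=
  fanoutFn lenBinF (fanoutFn (fun z => fstF (sndF (F.descFn z)) ++ extraUF F S q Py z) (sndPow 3 ∘ resF F S q Py))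

variable {F S q Py}

/-- **`descF ∈ FP`** for uniform `F`, `S`. [cite: AroraBarak2009, §6.2 Def. 6.12 and Remark 6.7] -/
theorem descF_mem_FP (hF : F.IsUniform) (hS : S.IsUniform) : descF F S q Py ∈ FP := by
  obtain ⟨pS, hpS⟩ := exists_poly_length_le_of_mem_FP (TidyFamily.ddF_mem_FP_of_isUniform hS)
  have hd := QCircuitFamily.descFn_mem_FP_of_isUniform hF
  have hctx : ctxF q Py ∈ FP := fanoutFn_mem_FP (polyFn_mem_FP _) (polyFn_mem_FP _)
  have hN : NbinF F ∈ FP := comp_mem_FP addFn_mem_FP (fanoutFn_mem_FP lenBinF_mem_FP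
    (comp_mem_FP lenBinF_mem_FP (comp_mem_FP fstF_mem_FP (comp_mem_FP sndF_mem_FP hd))))
  have hinit : initF F q Py ∈ FP := fanoutFn_mem_FP hctx (fanoutFn_mem_FP (comp_mem_FP lenBinF_mem_FP hctx)
    (fanoutFn_mem_FP (comp_mem_FP sndF_mem_FP (comp_mem_FP sndF_mem_FP hd)) (fanoutFn_mem_FP hN (const_mem_FP _))))
  have hloop : loopF S ∈ FP := loopFn_mem_FP_of_poly (body_mem_FP hS) (bodyPoly pS) (length_body_le pS hpS) X
  have hres : resF F S q Py ∈ FP := comp_mem_FP hloop hinit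
  have hex : extraUF F S q Py ∈ FP := comp_mem_FP binToUnaryFn_mem_FP (fanoutFn_mem_FP (polyFn_mem_FP _)
    (comp_mem_FP subFn_mem_FP (fanoutFn_mem_FP (comp_mem_FP (nthF_mem_FP 3) hres) hN)))
  have hanc : (fun z => fstF (sndF (F.descFn z)) ++ extraUF F S q Py z) ∈ FP :=
    append_mem_FP (comp_mem_FP fstF_mem_FP (comp_mem_FP sndF_mem_FP hd)) hex
  exact fanoutFn_mem_FP lenBinF_mem_FP (fanoutFn_mem_FP hanc (comp_mem_FP (sndPow_mem_FP 3) hres))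

/-- The ancilla count of the substituted family. [folklore] -/
theorem substFamily_ancillas (n : ℕ) :
    (OracleImpl.substFamily F fun n => S.fix (q.eval n)).ancillas n = F.ancillas n + (S.fix (q.eval n)).extra (F.circ n).gates := rfl

/-- The description of the substituted circuit. [folklore] -/
theorem encode_substFamily_circ (n : ℕ) (hNW : n + F.ancillas n ≤ n + (F.ancillas n + (S.fix (q.eval n)).extra (F.circ n).gates)) :
    ((OracleImpl.substFamily F fun n => S.fix (q.eval n)).circ n).encode =
      encList ((OracleImpl.substGates (S.fix (q.eval n)) hNW (n + F.ancillas n) (F.circ n).gates).map QGate.encode) :=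
  QCircuit.encode_eq_encList _

/-- **`descF` is the description function of the substituted family** when the yardstick polynomial
`Py` dominates the width of the substituted circuit and the blocks. [cite: BennettBernsteinBrassardVazirani1997, Cor. 4.15] -/
theorem descF_apply (M : ℕ → ℕ)
    (hM : ∀ n k (e : Fin (k + 1) ↪ Fin (n + F.ancillas n)), QGate.oracle k e ∈ (F.circ n).gates →
      (S.circ k (q.eval n)).size ≤ M n ∧ k + 1 + S.anc k (q.eval n) ≤ M n)
    (hPy : ∀ n, n + (F.ancillas n + (S.fix (q.eval n)).extra (F.circ n).gates) ≤ Py.eval n ∧ M n ≤ Py.eval n ∧ (F.circ n).size ≤ Py.eval n)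
    (z : List Bool) :
    descF F S q Py z = (OracleImpl.substFamily F fun n => S.fix (q.eval n)).descFn z := by
  obtain ⟨hPy1, hPy2, hPy3⟩ := hPy z.length
  have hNW : z.length + F.ancillas z.length ≤ z.length + (F.ancillas z.length + (S.fix (q.eval z.length)).extra (F.circ z.length).gates) := by omega
  have hyl : (ones (Py.eval z.length)).length = Py.eval z.length := by simp [ones]
  -- the given description
  have hdesc : F.descFn z = boolPair (encodeNat z.length) (boolPair (unaryEncodeNat (F.ancillas z.length)) (F.circ z.length).encode) :=
    QCircuitFamily.descFn_eq F z
  have hNbin : NbinF F z = encodeNat (z.length + F.ancillas z.length) := by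
    rw [NbinF, Function.comp_apply, fanoutFn_apply, lenBinF_apply, Function.comp_apply, Function.comp_apply, Function.comp_apply, hdesc,
      sndF_boolPair, fstF_boolPair, lenBinF_apply, DeciderFamily.length_unaryEncodeNat, addFn_boolPair, bitsToNat_encodeNat, bitsToNat_encodeNat]
  have hcodes : codesF F z = encList ((F.circ z.length).gates.map QGate.encode) := by
    rw [codesF, Function.comp_apply, Function.comp_apply, hdesc, sndF_boolPair, sndF_boolPair, QCircuit.encode_eq_encList]
  have hctx : ctxF q Py z = boolPair (ones (Py.eval z.length)) (ones (q.eval z.length)) := by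
    rw [ctxF, fanoutFn_apply, polyFn_apply, polyFn_apply]
  have hinit : initF F q Py z = boolPair (boolPair (ones (Py.eval z.length)) (ones (q.eval z.length)))
      (boolPair (encodeNat (boolPair (ones (Py.eval z.length)) (ones (q.eval z.length))).length)
        (stateStr (F.circ z.length).gates (z.length + F.ancillas z.length) [])) := by
    rw [initF, fanoutFn_apply, fanoutFn_apply, fanoutFn_apply, fanoutFn_apply, Function.comp_apply, hctx, lenBinF_apply, hcodes, hNbin, stateStr,
      encList_nil]
  -- the run
  have hrounds : (F.circ z.length).gates.length ≤ (boolPair (ones (Py.eval z.length)) (ones (q.eval z.length))).length := by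
    rw [length_boolPair, hyl]; exact le_trans hPy3 (by omega)
  have hrun := loopModel_run (S := S) (q.eval z.length) (ones (Py.eval z.length)) [] hNW (M z.length) (by rw [hyl]; exact hPy1)
    (by rw [hyl]; exact hPy2) (F.circ z.length).gates (boolPair (ones (Py.eval z.length)) (ones (q.eval z.length))).length
    (z.length + F.ancillas z.length) [] hrounds le_rfl (by omega) (fun g hg k e hge => by subst hge; exact hM z.length k e hg)
  rw [List.nil_append] at hrun
  have hres : resF F S q Py z = boolPair (boolPair (ones (Py.eval z.length)) (ones (q.eval z.length))) (boolPair []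
      (stateStr ([] : List (QGate cliffordT (z.length + F.ancillas z.length)))
        (z.length + F.ancillas z.length + (S.fix (q.eval z.length)).extra (F.circ z.length).gates)
        ((OracleImpl.substGates (S.fix (q.eval z.length)) hNW (z.length + F.ancillas z.length) (F.circ z.length).gates).map QGate.encode))) := by
    rw [resF, Function.comp_apply, hinit, loopF, fstF_boolPair, eval_X, iterate_loopStep (body S) _ _ _ _ le_rfl, hrun]
  have hacc : (sndPow 3 ∘ resF F S q Py) z =
      encList ((OracleImpl.substGates (S.fix (q.eval z.length)) hNW (z.length + F.ancillas z.length) (F.circ z.length).gates).map QGate.encode) := by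
    rw [Function.comp_apply, hres, stateStr, sndPow_succ_boolPair, sndPow_succ_boolPair, sndPow_succ_boolPair, sndPow_zero_boolPair]
  have hoff : (nthF 3 ∘ resF F S q Py) z = encodeNat (z.length + F.ancillas z.length + (S.fix (q.eval z.length)).extra (F.circ z.length).gates) := by
    rw [Function.comp_apply, hres, stateStr, nthF_succ_boolPair, nthF_succ_boolPair, nthF_succ_boolPair, nthF_zero_boolPair]
  have hextra : extraUF F S q Py z = ones ((S.fix (q.eval z.length)).extra (F.circ z.length).gates) := by
    rw [extraUF, Function.comp_apply, fanoutFn_apply, polyFn_apply, Function.comp_apply, fanoutFn_apply, hoff, hNbin, subFn_boolPair,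
      bitsToNat_encodeNat, bitsToNat_encodeNat, Nat.add_sub_cancel_left, binToUnaryFn_boolPair, bitsToNat_encodeNat, hyl,
      Nat.min_eq_left (by omega)]
  -- assemble
  have e1 : unaryEncodeNat ((OracleImpl.substFamily F fun n => S.fix (q.eval n)).ancillas z.length) =
      unaryEncodeNat (F.ancillas z.length) ++ ones ((S.fix (q.eval z.length)).extra (F.circ z.length).gates) := by
    rw [substFamily_ancillas, RevDesc.unaryEncodeNat_eq_replicate, RevDesc.unaryEncodeNat_eq_replicate, ones, List.replicate_add]
  rw [QCircuitFamily.descFn_eq, descF, fanoutFn_apply, fanoutFn_apply, lenBinF_apply, hacc, hextra, hdesc, sndF_boolPair, fstF_boolPair, e1,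
    encode_substFamily_circ (F := F) (S := S) (q := q) z.length hNW]

end Desc

end SubstUniform

/-! ### The uniformity theorem -/

/-- **The substituted family is uniform** (Bennett–Bernstein–Brassard–Vazirani 1997, Cor. 4.15, the
running time: the oracle machine with each call replaced by a polynomial-time tidy machine is
polynomial time; here: the description of the substituted family is printed in polynomial time by one
counted loop over the gate codes of the given family). [cite: BennettBernsteinBrassardVazirani1997, Cor. 4.15 (BQP^BQP = BQP)] -/
theorem substFamily_isUniform {F : QCircuitFamily Cryptography.cliffordT} {S : TidyFamily Cryptography.cliffordT} (q : Polynomial ℕ)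
    (hF : F.IsUniform) (hS : S.IsUniform) : (OracleImpl.substFamily F fun n => S.fix (q.eval n)).IsUniform := by
  classical
  -- polynomial bounds of the two description functions
  obtain ⟨pd, hpd⟩ := exists_poly_length_le_of_mem_FP (QCircuitFamily.descFn_mem_FP_of_isUniform hF)
  obtain ⟨pS, hpS⟩ := exists_poly_length_le_of_mem_FP (TidyFamily.ddF_mem_FP_of_isUniform hS)
  -- sizes of `F`
  have hsize : ∀ n, (F.circ n).size ≤ pd.eval n ∧ F.ancillas n ≤ pd.eval n := fun n => by
    have h := hpd (ones n)
    rw [QCircuitFamily.descFn_eq, length_boolPair, length_boolPair] at h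
    have e : (ones n).length = n := by simp [ones]
    rw [e] at h
    have h1 := QCircuit.size_le_length_encode (F.circ n)
    have h2 : (unaryEncodeNat (F.ancillas n)).length = F.ancillas n := DeciderFamily.length_unaryEncodeNat _
    exact ⟨by omega, by omega⟩
  -- sizes of the blocks for `k < n + pd n`
  let Mp : Polynomial ℕ := pS.comp (C 2 * (X + pd) + C 2 + q) + X + pd + C 1
  have hblock : ∀ n k, k + 1 ≤ n + F.ancillas n → (S.circ k (q.eval n)).size ≤ Mp.eval n ∧ k + 1 + S.anc k (q.eval n) ≤ Mp.eval n := by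
    intro n k hk
    have h := hpS (unaryPairEncode (k, q.eval n))
    rw [TidyFamily.ddF_apply, length_boolPair, length_boolPair] at h
    have hl : (unaryPairEncode (k, q.eval n)).length = 2 * k + 2 + q.eval n := by
      simp [unaryPairEncode, DeciderFamily.length_unaryEncodeNat]
    rw [hl] at h
    have hMp : Mp.eval n = pS.eval (2 * (n + pd.eval n) + 2 + q.eval n) + n + pd.eval n + 1 := by
      simp only [Mp, eval_comp, eval_add, eval_mul, eval_C, eval_X]
    have hmono : pS.eval (2 * k + 2 + q.eval n) ≤ pS.eval (2 * (n + pd.eval n) + 2 + q.eval n) := by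
      refine TM2Iter.eval_mono pS ?_
      have := (hsize n).2; omega
    have h1 := QCircuit.size_le_length_encode (S.circ k (q.eval n))
    have h2 : (unaryEncodeNat (S.anc k (q.eval n))).length = S.anc k (q.eval n) := DeciderFamily.length_unaryEncodeNat _
    have h4 := (hsize n).2
    rw [hMp]
    constructor <;> omega
  -- the total of fresh wires
  have hextra : ∀ n, (S.fix (q.eval n)).extra (F.circ n).gates ≤ (F.circ n).size * Mp.eval n := by
    intro n
    have key : ∀ gs : List (QGate cliffordT (n + F.ancillas n)), (∀ g ∈ gs, g ∈ (F.circ n).gates) →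
        (S.fix (q.eval n)).extra gs ≤ gs.length * Mp.eval n := by
      intro gs hgs
      induction gs with
      | nil => exact Nat.zero_le _
      | cons g gs ih =>
        have ih' := ih (fun g' hg' => hgs g' (List.mem_cons_of_mem _ hg'))
        cases g with
        | gate s e =>
          have hex : (S.fix (q.eval n)).extra (QGate.gate s e :: gs) = (S.fix (q.eval n)).extra gs := rfl
          rw [hex, List.length_cons, Nat.succ_mul]; omega
        | oracle k e =>
          have hk : k + 1 ≤ n + F.ancillas n := by simpa using Fintype.card_le_of_embedding e
          have := (hblock n k hk).2
          have hex : (S.fix (q.eval n)).extra (QGate.oracle k e :: gs) = S.anc k (q.eval n) + (S.fix (q.eval n)).extra gs := rfl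
          rw [hex, List.length_cons, Nat.succ_mul]; omega
    exact key _ (fun g hg => hg)
  let Py : Polynomial ℕ := X + pd + pd * Mp + Mp + pd + 1
  refine QCircuitFamily.isUniform_of_descFn_mem_FP ?_
  have h := SubstUniform.descF_mem_FP (q := q) (Py := Py) hF hS
  refine (congrArg (· ∈ FP) (funext fun z => ?_)).mp h
  refine SubstUniform.descF_apply (fun n => Mp.eval n) (fun n k e hg => hblock n k (by simpa using Fintype.card_le_of_embedding e)) (fun n => ?_) z
  have h1 := hextra n
  have h2 := (hsize n).1
  have h3 := (hsize n).2
  have hP : Py.eval n = n + pd.eval n + pd.eval n * Mp.eval n + Mp.eval n + pd.eval n + 1 := by simp [Py]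
  rw [hP]
  refine ⟨?_, by omega, by omega⟩
  nlinarith

end Literature.Computability.QuantumComplexity

end
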